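import Mathlib
import HarnessLib
import Literature.Combinatorics.SimpleGraph.EliminationGraph

/-!
# LatticeQCDFlow / Scaling — elimination fronts are boundaries of lower components; an
# isoperimetric lower bound on the elimination width of EVERY ordering

HONEST FRAMING: exact (Metropolis-corrected) sampling algorithms for lattice gauge theory;
figures of merit are autocorrelation/cost numbers at stated couplings and volumes; no
continuum-physics claim.

Venture `LatticeQCDFlow` (cell pub-lqcd), topic `Scaling`, FANOUT row 30 (lean-1) — OUR WORK, file 1
of the AUTOREGRESSIVE-CONTEXT (ELIMINATION-FRONT) VOLUME LAW (THEORY-2.md §4 row T2-AF (b)/(d): "in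
EVERY ordering some component needs context `≥ tw(G)`").  An exact autoregressive (Knothe–Rosenblatt,
triangular) sampler of a Markov random field with interaction graph `G` generates the sites in
some linear order; the conditional law of a site `v` given the sites generated before it reads the
FILL neighbourhood of `v` — in the convention of the tree's `EliminationGraph.lean` (LARGEST vertex
first) the higher neighbourhood `adj⁺_*(v)` of `v` in the elimination graph `G*_σ` ([VA15, §6.1]:
`{v,w} ∈ E*_σ` iff a `v`–`w` path with interior below both).  For an ARBITRARY linear order:

* `lowerComp G v` (the vertices joined to `v` by a walk inside `{u ≤ v}`), `outer G D` (outer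
  vertex boundary); **`higherAdj_elimGraph_eq_outer_lowerComp`**: `adj⁺_*(v) = ∂(lowerComp v)` —
  the fill neighbourhood of `v` IS the front of its lower component (`≤ elimWidth`).
* `pieceBelow G t y` (the piece of `y` strictly below `t`) is the lower component of its largest
  vertex (`pieceBelow_eq_lowerComp_of_isGreatest`); **`exists_lowerComp_balanced`**: in a connected graph on `n ≥ 3` vertices with degrees
  `≤ Δ`, for EVERY linear order some lower component `D` has `n ≤ 2Δ·|D| + 2` and `2|D| < n` (split
  the lower component of the least vertex whose lower component holds half of the vertices).
* **`le_elimWidth_of_isoperimetry`**, `le_treewidth_of_isoperimetry`: an isoperimetric inequality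
  `w ≤ |∂A|` on that size range forces `w ≤ elimWidth` for EVERY ordering and `w ≤ tw(G)`;
  **`isClique_outer_lowerComp`**, `exists_isClique_elimGraph_of_isoperimetry`: the front is a
  CLIQUE of the filled graph, so there are `≥ w(w-1)/2` fill edges among `≥ w` front vertices.
The torus instance (`(ℤ/L)^d`: `w = c_d·L^{d-1}`) is the sequel `Scaling/EliminationFrontTorus.lean`;
the Gaussian / Cholesky reading (no cancellation for Stieltjes precisions, the free field) follows
it.  Elementary given the tree's `EliminationGraph.lean` (L. Vandenberghe, M. S. Andersen, Found.
Trends Optim. 1 (2015) §6.1/§6.6; Rose–Tarjan–Lueker 1976); nothing is cited as a fact; no `sorry`.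
-/

namespace Summit.Ventures.LatticeQCDFlow.Theory2.Autoregressive

open Literature.Combinatorics.SimpleGraph Literature.LinearAlgebra.Matrix.ChordalSparsity

variable {V : Type*}

/-! ## 1. Lower components and outer boundaries -/

section LowerComp

variable [LinearOrder V] (G : SimpleGraph V)

/-- The LOWER COMPONENT of `v`: all `u` joined to `v` by a walk of `G` whose vertices are all `≤ v`
(the connected component of `v` in the subgraph induced on `{u | u ≤ v}`). [folklore] -/
def lowerComp (v : V) : Set V :=
  {u | ∃ p : G.Walk v u, ∀ z ∈ p.support, z ≤ v}

/-- The PIECE of `y` strictly BELOW the threshold `t`: all `u` joined to `y` by a walk whose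
vertices are all `< t`. [folklore] -/
def pieceBelow (t y : V) : Set V :=
  {u | ∃ p : G.Walk y u, ∀ z ∈ p.support, z < t}

/-- The OUTER VERTEX BOUNDARY of a vertex set `D`: vertices outside `D` with a neighbour in `D`.
[folklore] -/
def outer (D : Set V) : Set V :=
  {w | w ∉ D ∧ ∃ u ∈ D, G.Adj u w}

variable {G}

/-- `v` lies in its own lower component. [folklore] -/
theorem mem_lowerComp_self (v : V) : v ∈ lowerComp G v :=
  ⟨SimpleGraph.Walk.nil, fun z hz => by simp_all⟩

/-- Lower components lie below their vertex. [folklore] -/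
theorem le_of_mem_lowerComp {v u : V} (hu : u ∈ lowerComp G v) : u ≤ v :=
  hu.elim fun p hp => hp u p.end_mem_support

/-- A lower component is closed under steps to neighbours `≤ v`. [folklore] -/
theorem mem_lowerComp_of_adj {v u w : V} (hu : u ∈ lowerComp G v) (huw : G.Adj u w) (hw : w ≤ v) :
    w ∈ lowerComp G v := by
  obtain ⟨p, hp⟩ := hu
  refine ⟨p.append huw.toWalk, fun z hz => ?_⟩
  rw [SimpleGraph.Walk.mem_support_append_iff] at hz
  rcases hz with hz | hz
  · exact hp z hz
  · rw [SimpleGraph.Walk.support_cons, SimpleGraph.Walk.support_nil, List.mem_cons,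
      List.mem_singleton] at hz
    rcases hz with rfl | rfl
    · exact hp _ p.end_mem_support
    · exact hw

/-- Pieces lie strictly below their threshold. [folklore] -/
theorem lt_of_mem_pieceBelow {t y u : V} (hu : u ∈ pieceBelow G t y) : u < t :=
  hu.elim fun p hp => hp u p.end_mem_support

/-- `y < t` lies in its own piece. [folklore] -/
theorem mem_pieceBelow_self {t y : V} (hy : y < t) : y ∈ pieceBelow G t y :=
  ⟨SimpleGraph.Walk.nil, fun z hz => by
    rw [SimpleGraph.Walk.support_nil, List.mem_singleton] at hz
    exact hz ▸ hy⟩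

/-- A piece is closed under steps to neighbours below the threshold. [folklore] -/
theorem mem_pieceBelow_of_adj {t y u w : V} (hu : u ∈ pieceBelow G t y) (huw : G.Adj u w)
    (hw : w < t) : w ∈ pieceBelow G t y := by
  obtain ⟨p, hp⟩ := hu
  refine ⟨p.append huw.toWalk, fun z hz => ?_⟩
  rw [SimpleGraph.Walk.mem_support_append_iff] at hz
  rcases hz with hz | hz
  · exact hp z hz
  · rw [SimpleGraph.Walk.support_cons, SimpleGraph.Walk.support_nil, List.mem_cons,
      List.mem_singleton] at hz
    rcases hz with rfl | rfl
    · exact hp _ p.end_mem_support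
    · exact hw

/-- Every vertex ON a walk from `y` below the threshold lies in the piece of `y`. [folklore] -/
theorem mem_pieceBelow_of_mem_support {t y u : V} (p : G.Walk y u)
    (hp : ∀ z ∈ p.support, z < t) {z : V} (hz : z ∈ p.support) : z ∈ pieceBelow G t y := by
  classical
  exact ⟨p.takeUntil z hz, fun x hx => hp x (p.support_takeUntil_subset_support hz hx)⟩

/-- Pieces are transitive: the piece of a member is contained in the piece. [folklore] -/
theorem pieceBelow_subset_of_mem {t y y' : V} (hy' : y' ∈ pieceBelow G t y) :
    pieceBelow G t y' ⊆ pieceBelow G t y := by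
  rintro u ⟨q, hq⟩
  obtain ⟨p, hp⟩ := hy'
  refine ⟨p.append q, fun z hz => ?_⟩
  rw [SimpleGraph.Walk.mem_support_append_iff] at hz
  rcases hz with hz | hz
  exacts [hp z hz, hq z hz]

/-- Pieces are symmetric: membership is mutual. [folklore] -/
theorem mem_pieceBelow_comm {t y u : V} (hu : u ∈ pieceBelow G t y) : y ∈ pieceBelow G t u := by
  obtain ⟨p, hp⟩ := hu
  exact ⟨p.reverse, fun z hz => hp z (by simpa using hz)⟩

/-- **Every piece below a threshold is the lower component of its largest vertex.** [folklore] -/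
theorem pieceBelow_eq_lowerComp_of_isGreatest {t y m : V}
    (hm : IsGreatest (pieceBelow G t y) m) : pieceBelow G t y = lowerComp G m := by
  ext u
  constructor
  · intro hu
    -- walk `m → y → u` inside the piece, all of whose vertices are `≤ m`
    obtain ⟨p, hp⟩ := mem_pieceBelow_comm hm.1
    obtain ⟨q, hq⟩ := hu
    refine ⟨p.append q, fun z hz => hm.2 ?_⟩
    rw [SimpleGraph.Walk.mem_support_append_iff] at hz
    rcases hz with hz | hz
    · exact pieceBelow_subset_of_mem hm.1 (mem_pieceBelow_of_mem_support p hp hz)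
    · exact mem_pieceBelow_of_mem_support q hq hz
  · rintro ⟨q, hq⟩
    have hmt : m < t := lt_of_mem_pieceBelow hm.1
    obtain ⟨p, hp⟩ := hm.1
    refine ⟨p.append q, fun z hz => ?_⟩
    rw [SimpleGraph.Walk.mem_support_append_iff] at hz
    rcases hz with hz | hz
    exacts [hp z hz, (hq z hz).trans_lt hmt]

/-- In a finite vertex type every piece of some `y < t` is the lower component of SOME vertex
`m < t`. [folklore] -/
theorem exists_pieceBelow_eq_lowerComp [Finite V] {t y : V} (hy : y < t) :
    ∃ m, m < t ∧ pieceBelow G t y = lowerComp G m := by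
  have hfin : (pieceBelow G t y).Finite := Set.toFinite _
  obtain ⟨m, hm⟩ := Set.exists_max_image _ id hfin ⟨y, mem_pieceBelow_self hy⟩
  exact ⟨m, lt_of_mem_pieceBelow hm.1, pieceBelow_eq_lowerComp_of_isGreatest ⟨hm.1, hm.2⟩⟩

/-! ## 2. The fill neighbourhood of `v` is the outer boundary of its lower component -/

/-- Walk induction behind `adj⁺_*(v) ⊆ ∂(lowerComp v)`: a walk from a point of the lower
component to `w`, all of whose vertices are `≤ v` or equal to `w`, with `¬ w ≤ v`, enters `w`
from the lower component. [folklore] -/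
theorem exists_adj_of_walk_to {v w : V} (hw : ¬ w ≤ v) :
    ∀ {a : V} (p : G.Walk a w), a ∈ lowerComp G v →
      (∀ z ∈ p.support, z ≤ v ∨ z = w) → ∃ u ∈ lowerComp G v, G.Adj u w
  | _, .nil, ha, _ => absurd (le_of_mem_lowerComp ha) hw
  | a, .cons (v := b) hab p, ha, hp => by
    by_cases hb : b = w
    · subst hb
      exact ⟨a, ha, hab⟩
    · have hb' : b ≤ v := by
        rcases hp b (by simp) with h | h
        exacts [h, absurd h hb]
      exact exists_adj_of_walk_to hw p (mem_lowerComp_of_adj ha hab hb')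
        fun z hz => hp z (by simp [hz])

/-- **THE FILL NEIGHBOURHOOD OF `v` IS THE FRONT OF ITS LOWER COMPONENT**:
`adj⁺_*(v) = ∂(lowerComp v)` — `w ≻ v` is joined to `v` by a path with interior below `v`
([VA15, Thm 6.1]) iff `w` is an outer-boundary vertex of the lower component of `v`. [folklore] -/
theorem higherAdj_elimGraph_eq_outer_lowerComp (v : V) :
    higherAdj (elimGraph G).Adj v = outer G (lowerComp G v) := by
  ext w
  rw [mem_higherAdj_iff, elimGraph_adj_iff]
  constructor
  · rintro ⟨hvw, -, p, hp⟩
    have hw : ¬ w ≤ v := not_le.mpr hvw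
    refine ⟨fun h => hw (le_of_mem_lowerComp h), ?_⟩
    exact exists_adj_of_walk_to hw p (mem_lowerComp_self v) fun z hz => by
      rcases hp z hz with h | h | h
      exacts [Or.inl h.le, Or.inr h, Or.inl h.1.le]
  · rintro ⟨hwD, u, hu, huw⟩
    have hvw : v < w := by
      by_contra h
      exact hwD (mem_lowerComp_of_adj hu huw (not_lt.mp h))
    refine ⟨hvw, hvw.ne, ?_⟩
    obtain ⟨p, hp⟩ := hu
    refine ⟨p.append huw.toWalk, fun z hz => ?_⟩
    rw [SimpleGraph.Walk.mem_support_append_iff] at hz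
    rcases hz with hz | hz
    · rcases (hp z hz).lt_or_eq with h | h
      exacts [Or.inr (Or.inr ⟨h, h.trans hvw⟩), Or.inl h]
    · rw [SimpleGraph.Walk.support_cons, SimpleGraph.Walk.support_nil, List.mem_cons,
        List.mem_singleton] at hz
      rcases hz with rfl | rfl
      · rcases (hp _ p.end_mem_support).lt_or_eq with h | h
        exacts [Or.inr (Or.inr ⟨h, h.trans hvw⟩), Or.inl h]
      · exact Or.inr (Or.inl rfl)

/-- Hence the front of every lower component is at most the elimination width. [folklore] -/
theorem ncard_outer_lowerComp_le_elimWidth [Fintype V] (v : V) :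
    (outer G (lowerComp G v)).ncard ≤ elimWidth G := by
  rw [← higherAdj_elimGraph_eq_outer_lowerComp]
  exact ncard_higherAdj_elimGraph_le_elimWidth v

/-- **The front of a lower component is a CLIQUE of the elimination graph** (all its vertices are
higher fill-neighbours of `v`; monotone transitivity). [folklore] -/
theorem isClique_outer_lowerComp (v : V) : (elimGraph G).IsClique (outer G (lowerComp G v)) := by
  intro j hj k hk hjk
  rw [← higherAdj_elimGraph_eq_outer_lowerComp] at hj hk
  rw [mem_higherAdj_iff] at hj hk
  exact monotoneTransitive_elimGraph hj.1 hk.1 hjk hj.2 hk.2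

/-! ## 3. The balanced lower component -/

/-- Walk induction behind the splitting of a lower component at its vertex: every vertex of
`lowerComp t` other than `t` lies in the piece below `t` of a LOWER NEIGHBOUR of `t`. [folklore] -/
theorem exists_mem_pieceBelow_of_walk {t : V} :
    ∀ {a u : V} (p : G.Walk a u), (∀ z ∈ p.support, z ≤ t) →
      (a = t ∨ ∃ y, G.Adj t y ∧ y < t ∧ a ∈ pieceBelow G t y) → u ≠ t →
      ∃ y, G.Adj t y ∧ y < t ∧ u ∈ pieceBelow G t y
  | _, _, .nil, _, ha, hu => by
    rcases ha with h | h
    exacts [absurd h hu, h]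
  | a, u, .cons (v := b) hab p, hp, ha, hu => by
    have hb : b ≤ t := hp b (by simp)
    rcases hb.lt_or_eq with hb | rfl
    · refine exists_mem_pieceBelow_of_walk p (fun z hz => hp z (by simp [hz])) (Or.inr ?_) hu
      rcases ha with rfl | ⟨y, hty, hy, hay⟩
      · exact ⟨b, hab, hb, mem_pieceBelow_self hb⟩
      · exact ⟨y, hty, hy, mem_pieceBelow_of_adj hay hab hb⟩
    · exact exists_mem_pieceBelow_of_walk p (fun z hz => hp z (by simp [hz])) (Or.inl rfl) hu

/-- The lower component of `t` minus `t` is covered by the pieces below `t` of the lower neighbours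
of `t`. [folklore] -/
theorem lowerComp_subset_biUnion_pieceBelow (t : V) :
    lowerComp G t ⊆ insert t (⋃ y ∈ {y | G.Adj t y ∧ y < t}, pieceBelow G t y) := by
  intro u hu
  by_cases hut : u = t
  · exact Or.inl hut
  · obtain ⟨p, hp⟩ := hu
    obtain ⟨y, hty, hy, huy⟩ := exists_mem_pieceBelow_of_walk p hp (Or.inl rfl) hut
    exact Or.inr (Set.mem_biUnion (show y ∈ {y | G.Adj t y ∧ y < t} from ⟨hty, hy⟩) huy)

/-- In a connected graph the lower component of the LARGEST vertex is everything. [folklore] -/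
theorem lowerComp_eq_univ_of_isMax (hG : G.Preconnected) {t : V} (ht : ∀ u, u ≤ t) :
    lowerComp G t = Set.univ := by
  ext u
  simp only [Set.mem_univ, iff_true]
  obtain ⟨p⟩ := hG t u
  exact ⟨p, fun z _ => ht z⟩

/-- **THE BALANCED LOWER COMPONENT.**  In a connected graph on `n ≥ 3` vertices all of whose
neighbourhoods have at most `Δ` vertices, for EVERY linear order of the vertices some lower
component `D = lowerComp m` satisfies `n ≤ 2Δ·|D| + 2` and `2|D| < n`.  Proof: the least vertex
`t` whose lower component holds `≥ n/2` vertices exists (the largest vertex qualifies); its lower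
component minus `t` is covered by the `≤ Δ` pieces below `t` of its lower neighbours, each of
which is the lower component of a vertex `< t`, hence of size `< n/2`; the largest piece does it.
[folklore] -/
theorem exists_lowerComp_balanced [Fintype V] (hG : G.Connected) (Δ : ℕ)
    (hΔ : ∀ v, (G.neighborSet v).ncard ≤ Δ) (h3 : 3 ≤ Fintype.card V) :
    ∃ m : V, Fintype.card V ≤ 2 * Δ * (lowerComp G m).ncard + 2 ∧
      2 * (lowerComp G m).ncard < Fintype.card V := by
  classical
  set n := Fintype.card V with hn
  -- the least vertex whose lower component holds half of the vertices
  set P : Finset V := Finset.univ.filter fun v => n ≤ 2 * (lowerComp G v).ncard with hP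
  have hne : (Finset.univ : Finset V).Nonempty := Finset.univ_nonempty_iff.mpr hG.nonempty
  have hPne : P.Nonempty := by
    refine ⟨Finset.univ.max' hne, Finset.mem_filter.mpr ⟨Finset.mem_univ _, ?_⟩⟩
    rw [lowerComp_eq_univ_of_isMax hG.preconnected fun u => Finset.le_max' _ u (Finset.mem_univ u),
      Set.ncard_univ, Nat.card_eq_fintype_card]
    omega
  set t := P.min' hPne with ht
  have htP : n ≤ 2 * (lowerComp G t).ncard := (Finset.mem_filter.mp (Finset.min'_mem P hPne)).2
  have hlt : ∀ m, m < t → 2 * (lowerComp G m).ncard < n := by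
    intro m hm
    by_contra h
    have hmP : m ∈ P := Finset.mem_filter.mpr ⟨Finset.mem_univ _, not_lt.mp h⟩
    exact absurd (Finset.min'_le P m hmP) (not_le.mpr (ht ▸ hm))
  -- the lower neighbours of `t` and their pieces
  set N : Finset V := Finset.univ.filter fun y => G.Adj t y ∧ y < t with hN
  have hNcard : N.card ≤ Δ := by
    refine le_trans ?_ (hΔ t)
    rw [Set.ncard_eq_toFinset_card' (G.neighborSet t)]
    refine Finset.card_le_card fun y hy => ?_
    rw [Set.mem_toFinset, SimpleGraph.mem_neighborSet]
    exact (Finset.mem_filter.mp hy).2.1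
  have hcover : lowerComp G t ⊆ insert t (⋃ y ∈ N, pieceBelow G t y) := by
    intro u hu
    rcases lowerComp_subset_biUnion_pieceBelow t hu with h | h
    · exact Or.inl h
    · refine Or.inr ?_
      simp only [Set.mem_iUnion, Set.mem_setOf_eq, exists_prop] at h
      obtain ⟨y, hy, huy⟩ := h
      exact Set.mem_biUnion (Finset.mem_filter.mpr ⟨Finset.mem_univ _, hy⟩) huy
  have hsize : (lowerComp G t).ncard ≤ 1 + ∑ y ∈ N, (pieceBelow G t y).ncard := by
    calc (lowerComp G t).ncard
        ≤ (insert t (⋃ y ∈ N, pieceBelow G t y)).ncard :=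
          Set.ncard_le_ncard hcover (Set.toFinite _)
      _ ≤ 1 + (⋃ y ∈ N, pieceBelow G t y).ncard := by
          rw [Nat.add_comm]; exact Set.ncard_insert_le _ _
      _ ≤ 1 + ∑ y ∈ N, (pieceBelow G t y).ncard := by
          refine Nat.add_le_add_left ?_ 1
          -- `|⋃_{y ∈ N} piece y| ≤ Σ_{y ∈ N} |piece y|` through `Finset.card_biUnion_le`
          have hU : (⋃ y ∈ N, pieceBelow G t y) =
              ↑(N.biUnion fun y => (pieceBelow G t y).toFinset) := by
            ext u; simp
          rw [hU, Set.ncard_coe_finset]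
          refine (Finset.card_biUnion_le).trans (Finset.sum_le_sum fun y _ => ?_)
          rw [Set.ncard_eq_toFinset_card']
  -- `N` is nonempty (else the lower component is `{t}` and `n ≤ 2`)
  have hNne : N.Nonempty := by
    by_contra hN0
    rw [Finset.not_nonempty_iff_eq_empty] at hN0
    rw [hN0, Finset.sum_empty] at hsize
    omega
  -- the largest piece
  obtain ⟨y₀, hy₀N, hy₀⟩ := Finset.exists_max_image N (fun y => (pieceBelow G t y).ncard) hNne
  have hsum : ∑ y ∈ N, (pieceBelow G t y).ncard ≤ Δ * (pieceBelow G t y₀).ncard :=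
    calc ∑ y ∈ N, (pieceBelow G t y).ncard
        ≤ ∑ _y ∈ N, (pieceBelow G t y₀).ncard := Finset.sum_le_sum hy₀
      _ = N.card * (pieceBelow G t y₀).ncard := by rw [Finset.sum_const, smul_eq_mul]
      _ ≤ Δ * (pieceBelow G t y₀).ncard := Nat.mul_le_mul_right _ hNcard
  have hy₀t : y₀ < t := ((Finset.mem_filter.mp hy₀N).2).2
  obtain ⟨m, hmt, hm⟩ := exists_pieceBelow_eq_lowerComp (G := G) hy₀t
  refine ⟨m, ?_, hlt m hmt⟩
  rw [← hm]
  have h1 := hsize.trans (Nat.add_le_add_left hsum 1)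
  have h2 : 2 * Δ * (pieceBelow G t y₀).ncard = 2 * (Δ * (pieceBelow G t y₀).ncard) := by ring
  omega

/-- **ELIMINATION WIDTH FROM ISOPERIMETRY, FOR EVERY ORDERING.**  If every vertex set `A` with
`n ≤ 2Δ|A| + 2` and `2|A| < n` has outer boundary of size `≥ w`, then the elimination width of EVERY
linear order is `≥ w` (the front of the balanced lower component). [folklore] -/
theorem le_elimWidth_of_isoperimetry [Fintype V] (hG : G.Connected) (Δ w : ℕ)
    (hΔ : ∀ v, (G.neighborSet v).ncard ≤ Δ) (h3 : 3 ≤ Fintype.card V)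
    (hiso : ∀ A : Set V, Fintype.card V ≤ 2 * Δ * A.ncard + 2 → 2 * A.ncard < Fintype.card V →
      w ≤ (outer G A).ncard) :
    w ≤ elimWidth G := by
  obtain ⟨m, h₁, h₂⟩ := exists_lowerComp_balanced hG Δ hΔ h3
  exact (hiso _ h₁ h₂).trans (ncard_outer_lowerComp_le_elimWidth m)

/-- **A CLIQUE OF THE FILLED GRAPH FROM ISOPERIMETRY**: under the same hypotheses the elimination
graph of EVERY ordering contains a clique on at least `w` vertices (the front of the balanced
lower component), hence at least `w(w-1)/2` fill edges joining front vertices. [folklore] -/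
theorem exists_isClique_elimGraph_of_isoperimetry [Fintype V] (hG : G.Connected) (Δ w : ℕ)
    (hΔ : ∀ v, (G.neighborSet v).ncard ≤ Δ) (h3 : 3 ≤ Fintype.card V)
    (hiso : ∀ A : Set V, Fintype.card V ≤ 2 * Δ * A.ncard + 2 → 2 * A.ncard < Fintype.card V →
      w ≤ (outer G A).ncard) :
    ∃ K : Finset V, w ≤ K.card ∧ (elimGraph G).IsClique (K : Set V) := by
  classical
  obtain ⟨m, h₁, h₂⟩ := exists_lowerComp_balanced hG Δ hΔ h3
  refine ⟨(outer G (lowerComp G m)).toFinset, ?_, ?_⟩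
  · rw [← Set.ncard_eq_toFinset_card']
    exact hiso _ h₁ h₂
  · rw [Set.coe_toFinset]
    exact isClique_outer_lowerComp m

end LowerComp

/-! ## 4. Order-free corollary: a treewidth lower bound -/

/-- **TREEWIDTH FROM ISOPERIMETRY**: the hypotheses of `le_elimWidth_of_isoperimetry` do not
mention the order, and some order has elimination width `tw(G)` ([VA15, §6.6]), so `w ≤ tw(G)`.
[folklore] -/
theorem le_treewidth_of_isoperimetry [Fintype V] [DecidableEq V] {G : SimpleGraph V}
    (hG : G.Connected) (Δ w : ℕ) (hΔ : ∀ v, (G.neighborSet v).ncard ≤ Δ) (h3 : 3 ≤ Fintype.card V)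
    (hiso : ∀ A : Set V, Fintype.card V ≤ 2 * Δ * A.ncard + 2 → 2 * A.ncard < Fintype.card V →
      w ≤ {x | x ∉ A ∧ ∃ u ∈ A, G.Adj u x}.ncard) :
    w ≤ treewidth G := by
  haveI : Nonempty V := hG.nonempty
  obtain ⟨o, ho⟩ := exists_linearOrder_elimWidth_eq_treewidth G
  letI : LinearOrder V := o
  rw [← ho]
  exact le_elimWidth_of_isoperimetry hG Δ w hΔ h3 hiso

end Summit.Ventures.LatticeQCDFlow.Theory2.Autoregressive
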